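import Literature.Barriers.CriticalPhenomena.GaussianDominationRouteProp74Events
import Literature.Barriers.CriticalPhenomena.LaceExpansionXSpaceLemma16Proofs
import HarnessLib

/-!
# The pointwise diagrammatic bound (7.4.10) on the Hara–Slade coefficients `lacePiT`, and
# `HvdH2017_piNDiagramBoundPc_holds`

Barrier catalogue `Literature/Barriers/CriticalPhenomena/` (D-0021). Heydenreich–van der Hofstad
2017, §7.3–§7.4: the nested expectations (6.2.27) are bounded level by level — the LAST level by
(7.3.8)/(7.2.22) (`kerE_le_diagram`), the MIDDLE levels by (7.3.9) with BK (7.4.7)–(7.4.8)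
(`measure_laceE_inter_restrCluster_le`, `GaussianDominationRouteProp74Events.lean`), the FIRST
level by (7.2.24)/(7.4.5) (`measure_doubleConn_inter_le`) — and the resulting sum of products of
two-point functions is (7.4.10), "valid for all `N ≥ 1`":
`Π^{(N)}(x) ≤ Σ A₃(0,u₀,w₀) ∏ [B₁ B₂] B₁(w_{N-1},u_{N-1},z_N,t_N) A₃(z_N,t_N,x)`.

This file carries this out for the tree's `[0,∞]`-valued coefficients `lacePiT d p N`:

* `levelR d p k v z x` — the explicit bound of the `k + 1` innermost levels seen from the END `x`
  (a recursion from the inside, the form in which Tonelli is applied level by level), and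
  `nestIter_kerE_le_levelR : (𝒩ᵏ kerE)(A, v, x) ≤ Σ_z 𝟙_A(z) levelR k v z x` (induction on `k`);
* `lacePiT_succ_le_levelR` — the first level: `Π̃^{(N+1)}(x) ≤ Σ_{(u₀,v₀)} J Σ_{z₁} [Σ_{w₀}
  τ(u₀)τ(w₀)τ(u₀-w₀)τ(z₁-w₀)] levelR N v₀ z₁ x`, for EVERY `p`;
* at `p = p_c`, the re-association of this sum into the organisation (7.4.10)/(7.5.5) of the book
  (the recursion `Ψ^{(N)}` from the origin, `percPsi`, and `piNDiagramPc` of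
  `LaceExpansionXSpaceLemma16.lean`): the sums over the far ends `v_{i-1}` of the bonds give
  `τ̃` and `B₁` ((7.4.6)–(7.4.7)), the sum over `t_i` in the `F''` term gives `B₂⁽²⁾` ((7.4.8)–(7.4.9)),
  and the two nestings (from `x`, from `0`) of the same product agree by Tonelli
  (`pairing_transfer`); whence `lacePiT_le_piNDiagramPc : Π̃^{(N)}_{p_c}(x) ≤ piNDiagramPc d N x`
  for `N ≥ 1`;
* `HvdH2017_piNDiagramBoundPc_holds` — DISCHARGE of the named fact, by
  `HvdH2017_piNDiagramBoundPc_of_pointwiseBound7410` (`LaceExpansionXSpaceLemma16Proofs.lean`).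

## References

* M. Heydenreich, R. van der Hofstad, *Progress in High-Dimensional Percolation and Random
  Graphs* (Springer 2017): (7.3.1)–(7.3.11), (7.4.1)–(7.4.10), (7.5.5)–(7.5.6), Lemma 7.1,
  Cor. 8.13.
* G. Slade, *The Lace Expansion and its Applications* (LNM 1879, 2006): (10.32)–(10.53).
* T. Hara, G. Slade, Comm. Math. Phys. 128 (1990) 333–391: §2.2, Lemma 2.5.
-/

noncomputable section

namespace Literature.Barriers.CriticalPhenomena

open _root_.MeasureTheory Literature.Probability.LatticeModels Literature.Probability.Percolation
open scoped ENNReal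

variable {d : ℕ}

/-! ### The level bounds from the inside -/

/-- The BK products of the two middle-level bounding events ((7.4.7) + (7.4.8) before the sums
over the bond and over `t`): `τ(t-v)τ(z-t)τ(w-t)τ(u-z)τ(u-w)τ(z₂-w) + τ(w-v)τ(t-w)τ(z-t)τ(u-t)τ(u-z)τ(z₂-w)`.
[cite: HeydenreichVanDerHofstad2017, (7.3.3)–(7.3.4) and (7.4.7)–(7.4.8)] -/
def stepF (d : ℕ) (p : unitInterval) (v t z u w z₂ : Site d) : ℝ≥0∞ :=
  tauE d p (t - v) * tauE d p (z - t) * tauE d p (w - t) * tauE d p (u - z) *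
      tauE d p (u - w) * tauE d p (z₂ - w) +
    tauE d p (w - v) * tauE d p (t - w) * tauE d p (z - t) * tauE d p (u - t) *
      tauE d p (u - z) * tauE d p (z₂ - w)

/-- **The inside-out level bound** `levelR k v z x`: for `k = 0` the last-level product (7.2.22),
`Σ_t τ(t-v)τ(z-t)τ(x-t)τ(x-z)`; for `k + 1`, one more level —
`Σ_{(u,v')} Σ_{z₂,t,w} J(u,v') stepF(v,t,z,u,w,z₂) · levelR k v' z₂ x`.
[cite: HeydenreichVanDerHofstad2017, (7.3.8)–(7.3.11)] -/
def levelR (d : ℕ) (p : unitInterval) : ℕ → Site d → Site d → Site d → ℝ≥0∞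
  | 0, v, z, x => ∑' t, tauE d p (t - v) * tauE d p (z - t) * tauE d p (x - t) * tauE d p (x - z)
  | k + 1, v, z, x => ∑' b : Site d × Site d, ∑' z₂, ∑' t, ∑' w,
      ENNReal.ofReal (bondJ d p (b.2 - b.1)) * stepF d p v t z b.1 w z₂ * levelR d p k b.2 z₂ x

/-- Unfolding lemma. [folklore] -/
theorem levelR_zero (p : unitInterval) (v z x : Site d) :
    levelR d p 0 v z x = ∑' t, tauE d p (t - v) * tauE d p (z - t) * tauE d p (x - t) * tauE d p (x - z) :=
  rfl

/-- Unfolding lemma. [folklore] -/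
theorem levelR_succ (p : unitInterval) (k : ℕ) (v z x : Site d) :
    levelR d p (k + 1) v z x = ∑' b : Site d × Site d, ∑' z₂, ∑' t, ∑' w,
      ENNReal.ofReal (bondJ d p (b.2 - b.1)) * stepF d p v t z b.1 w z₂ * levelR d p k b.2 z₂ x :=
  rfl

/-- **One level of the nesting, integrated**: for any `[0,∞]`-valued `R`,
`∫ 𝟙_{E'(v,u;A)}(ω) [Σ_{z₂} 𝟙{z₂ ∈ C̃^{(u,v')}(v)(ω)} R(z₂)] dP_p(ω)
≤ Σ_z 𝟙_A(z) Σ_{z₂,t,w} stepF(v,t,z,u,w,z₂) R(z₂)` (Tonelli and (7.3.9) with BK).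
[cite: HeydenreichVanDerHofstad2017, (7.3.9)–(7.3.11) and (7.4.7)–(7.4.8)] -/
theorem lintegral_indicator_laceE_tsum_le (p : unitInterval) (A : Set (Site d)) (v u v' : Site d)
    (R : Site d → ℝ≥0∞) :
    ∫⁻ ω, (laceE A v u).indicator
        (fun ω => ∑' z₂, {ω' | z₂ ∈ restrCluster u v' v ω'}.indicator (fun _ => (1 : ℝ≥0∞)) ω * R z₂) ω
        ∂(bondPercolation (zdGraph d) p) ≤
      ∑' z, A.indicator (fun _ => (1 : ℝ≥0∞)) z * ∑' z₂, ∑' t, ∑' w, stepF d p v t z u w z₂ * R z₂ := by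
  set μ := bondPercolation (zdGraph d) p with hμ
  set E₀ : Set (BondConfig (Site d)) := laceE A v u with hE₀
  set Ez : Site d → Set (BondConfig (Site d)) := fun z₂ => E₀ ∩ {ω | z₂ ∈ restrCluster u v' v ω} with hEz
  have hmeas : ∀ z₂, MeasurableSet (Ez z₂) := fun z₂ =>
    (measurableSet_laceE _ _ _).inter (measurable_set_iff.1 (measurable_restrCluster u v' v) z₂).setOf
  have hpt : ∀ ω, E₀.indicator
      (fun ω => ∑' z₂, {ω' | z₂ ∈ restrCluster u v' v ω'}.indicator (fun _ => (1 : ℝ≥0∞)) ω * R z₂) ω =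
        ∑' z₂, (Ez z₂).indicator (fun _ => (1 : ℝ≥0∞)) ω * R z₂ := by
    intro ω
    by_cases hω : ω ∈ E₀
    · rw [Set.indicator_of_mem hω]
      refine tsum_congr fun z₂ => ?_
      by_cases hz : z₂ ∈ restrCluster u v' v ω
      · rw [Set.indicator_of_mem (show ω ∈ {ω' | z₂ ∈ restrCluster u v' v ω'} from hz),
          Set.indicator_of_mem (show ω ∈ Ez z₂ from ⟨hω, hz⟩)]
      · rw [Set.indicator_of_notMem (show ω ∉ {ω' | z₂ ∈ restrCluster u v' v ω'} from hz),
          Set.indicator_of_notMem (show ω ∉ Ez z₂ from fun h => hz h.2)]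
    · rw [Set.indicator_of_notMem hω]
      symm
      refine (tsum_congr fun z₂ => ?_).trans tsum_zero
      rw [Set.indicator_of_notMem (show ω ∉ Ez z₂ from fun h => hω h.1), zero_mul]
  calc ∫⁻ ω, E₀.indicator (fun ω => ∑' z₂,
          {ω' | z₂ ∈ restrCluster u v' v ω'}.indicator (fun _ => (1 : ℝ≥0∞)) ω * R z₂) ω ∂μ
      = ∫⁻ ω, ∑' z₂, (Ez z₂).indicator (fun _ => (1 : ℝ≥0∞)) ω * R z₂ ∂μ := lintegral_congr hpt
    _ = ∑' z₂, ∫⁻ ω, (Ez z₂).indicator (fun _ => (1 : ℝ≥0∞)) ω * R z₂ ∂μ :=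
        lintegral_tsum fun z₂ => ((measurable_const.indicator (hmeas z₂)).mul_const _).aemeasurable
    _ = ∑' z₂, μ (Ez z₂) * R z₂ := by
        refine tsum_congr fun z₂ => ?_
        rw [lintegral_mul_const _ (measurable_const.indicator (hmeas z₂))]
        have h1 : ∫⁻ ω, (Ez z₂).indicator (fun _ => (1 : ℝ≥0∞)) ω ∂μ = μ (Ez z₂) :=
          lintegral_indicator_one (hmeas z₂)
        rw [h1]
    _ ≤ ∑' z₂, (∑' z, A.indicator (fun _ => (1 : ℝ≥0∞)) z * ∑' t, ∑' w, stepF d p v t z u w z₂) * R z₂ :=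
        ENNReal.tsum_le_tsum fun z₂ => mul_le_mul' (measure_laceE_inter_restrCluster_le p A v u v' z₂) le_rfl
    _ = ∑' z₂, ∑' z, A.indicator (fun _ => (1 : ℝ≥0∞)) z *
          ∑' t, ∑' w, stepF d p v t z u w z₂ * R z₂ := by
        refine tsum_congr fun z₂ => ?_
        rw [← ENNReal.tsum_mul_right]
        refine tsum_congr fun z => ?_
        rw [mul_assoc, ← ENNReal.tsum_mul_right]
        congr 1
        exact tsum_congr fun t => by rw [← ENNReal.tsum_mul_right]
    _ = ∑' z, A.indicator (fun _ => (1 : ℝ≥0∞)) z * ∑' z₂, ∑' t, ∑' w, stepF d p v t z u w z₂ * R z₂ := by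
        rw [ENNReal.tsum_comm]
        exact tsum_congr fun z => by rw [← ENNReal.tsum_mul_left]

/-- **The nested expectations are bounded by the level sums, from the inside**
((7.3.8)–(7.3.11) for the tree's nesting operator): for all `k, A, v, x`,
`(𝒩ᵏ kerE)(A, v, x) ≤ Σ_z 𝟙_A(z) · levelR k v z x`.
[cite: HeydenreichVanDerHofstad2017, (7.3.8)–(7.3.11)] -/
theorem nestIter_kerE_le_levelR (p : unitInterval) :
    ∀ (k : ℕ) (A : Set (Site d)) (v x : Site d),
      nestIter d p (kerE d p) k A v x ≤ ∑' z, A.indicator (fun _ => (1 : ℝ≥0∞)) z * levelR d p k v z x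
  | 0, A, v, x => by
      rw [nestIter_zero]
      refine (kerE_le_diagram p A v x).trans (le_of_eq (tsum_congr fun z => ?_))
      rw [levelR_zero, ← ENNReal.tsum_mul_left]
  | k + 1, A, v, x => by
      rw [nestIter_succ, nestOp_apply]
      calc ∑' b : Site d × Site d, ENNReal.ofReal (bondJ d p (b.2 - b.1)) *
            ∫⁻ ω, (laceE A v b.1).indicator
              (fun ω => nestIter d p (kerE d p) k (restrCluster b.1 b.2 v ω) b.2 x) ω
                ∂(bondPercolation (zdGraph d) p)
          ≤ ∑' b : Site d × Site d, ENNReal.ofReal (bondJ d p (b.2 - b.1)) *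
              ∫⁻ ω, (laceE A v b.1).indicator (fun ω => ∑' z₂,
                {ω' | z₂ ∈ restrCluster b.1 b.2 v ω'}.indicator (fun _ => (1 : ℝ≥0∞)) ω *
                  levelR d p k b.2 z₂ x) ω ∂(bondPercolation (zdGraph d) p) := by
            refine ENNReal.tsum_le_tsum fun b => mul_le_mul' le_rfl (lintegral_mono fun ω => ?_)
            refine Set.indicator_le_indicator' fun _ => ?_
            refine (nestIter_kerE_le_levelR p k _ b.2 x).trans (le_of_eq (tsum_congr fun z₂ => ?_))
            rfl
        _ ≤ ∑' b : Site d × Site d, ENNReal.ofReal (bondJ d p (b.2 - b.1)) *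
              ∑' z, A.indicator (fun _ => (1 : ℝ≥0∞)) z *
                ∑' z₂, ∑' t, ∑' w, stepF d p v t z b.1 w z₂ * levelR d p k b.2 z₂ x :=
            ENNReal.tsum_le_tsum fun b => mul_le_mul' le_rfl
              (lintegral_indicator_laceE_tsum_le p A v b.1 b.2 _)
        _ = ∑' b : Site d × Site d, ∑' z, A.indicator (fun _ => (1 : ℝ≥0∞)) z *
              (ENNReal.ofReal (bondJ d p (b.2 - b.1)) *
                ∑' z₂, ∑' t, ∑' w, stepF d p v t z b.1 w z₂ * levelR d p k b.2 z₂ x) := by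
            refine tsum_congr fun b => ?_
            rw [← ENNReal.tsum_mul_left]
            exact tsum_congr fun z => by rw [mul_left_comm]
        _ = ∑' z, A.indicator (fun _ => (1 : ℝ≥0∞)) z * levelR d p (k + 1) v z x := by
            rw [ENNReal.tsum_comm]
            refine tsum_congr fun z => ?_
            rw [ENNReal.tsum_mul_left, levelR_succ]
            congr 1
            refine tsum_congr fun b => ?_
            rw [← ENNReal.tsum_mul_left]
            refine tsum_congr fun z₂ => ?_
            rw [← ENNReal.tsum_mul_left]
            refine tsum_congr fun t => ?_
            rw [← ENNReal.tsum_mul_left]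
            exact tsum_congr fun w => by rw [mul_assoc]

/-- **The first level** ((7.3.2), (7.2.24), (7.4.5)): for every `p`, `N` and `x`,
`Π̃^{(N+1)}(x) ≤ Σ_{(u₀,v₀)} J(u₀,v₀) Σ_{z₁} [Σ_{w₀} τ(u₀)τ(w₀)τ(u₀-w₀)τ(z₁-w₀)] · levelR N v₀ z₁ x`.
[cite: HeydenreichVanDerHofstad2017, (7.3.10)–(7.3.11) and (7.4.5)] -/
theorem lacePiT_succ_le_levelR (p : unitInterval) (N : ℕ) (x : Site d) :
    lacePiT d p (N + 1) x ≤ ∑' b : Site d × Site d, ENNReal.ofReal (bondJ d p (b.2 - b.1)) *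
      ∑' z₁, (∑' w, tauE d p b.1 * tauE d p w * tauE d p (b.1 - w) * tauE d p (z₁ - w)) *
        levelR d p N b.2 z₁ x := by
  rw [lacePiT_succ, nestOp_apply]
  refine ENNReal.tsum_le_tsum fun b => mul_le_mul' le_rfl ?_
  set μ := bondPercolation (zdGraph d) p with hμ
  set E₀ : Set (BondConfig (Site d)) := laceE Set.univ 0 b.1 with hE₀
  set Ez : Site d → Set (BondConfig (Site d)) := fun z => E₀ ∩ {ω | z ∈ restrCluster b.1 b.2 0 ω} with hEz
  have hmeas : ∀ z, MeasurableSet (Ez z) := fun z =>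
    (measurableSet_laceE _ _ _).inter (measurable_set_iff.1 (measurable_restrCluster b.1 b.2 0) z).setOf
  have hpt : ∀ ω, E₀.indicator (fun ω => nestIter d p (kerE d p) N (restrCluster b.1 b.2 0 ω) b.2 x) ω ≤
      ∑' z, (Ez z).indicator (fun _ => (1 : ℝ≥0∞)) ω * levelR d p N b.2 z x := by
    intro ω
    by_cases hω : ω ∈ E₀
    · rw [Set.indicator_of_mem hω]
      refine (nestIter_kerE_le_levelR p N _ b.2 x).trans (ENNReal.tsum_le_tsum fun z => ?_)
      refine mul_le_mul' ?_ le_rfl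
      by_cases hz : z ∈ restrCluster b.1 b.2 0 ω
      · rw [Set.indicator_of_mem hz, Set.indicator_of_mem (show ω ∈ Ez z from ⟨hω, hz⟩)]
      · rw [Set.indicator_of_notMem hz]
        exact zero_le
    · rw [Set.indicator_of_notMem hω]
      exact zero_le
  calc ∫⁻ ω, E₀.indicator (fun ω => nestIter d p (kerE d p) N (restrCluster b.1 b.2 0 ω) b.2 x) ω ∂μ
      ≤ ∫⁻ ω, ∑' z, (Ez z).indicator (fun _ => (1 : ℝ≥0∞)) ω * levelR d p N b.2 z x ∂μ :=
        lintegral_mono hpt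
    _ = ∑' z, ∫⁻ ω, (Ez z).indicator (fun _ => (1 : ℝ≥0∞)) ω * levelR d p N b.2 z x ∂μ :=
        lintegral_tsum fun z => ((measurable_const.indicator (hmeas z)).mul_const _).aemeasurable
    _ = ∑' z, μ (Ez z) * levelR d p N b.2 z x := by
        refine tsum_congr fun z => ?_
        rw [lintegral_mul_const _ (measurable_const.indicator (hmeas z))]
        have h1 : ∫⁻ ω, (Ez z).indicator (fun _ => (1 : ℝ≥0∞)) ω ∂μ = μ (Ez z) :=
          lintegral_indicator_one (hmeas z)
        rw [h1]
    _ ≤ _ := ENNReal.tsum_le_tsum fun z =>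
        mul_le_mul' (measure_doubleConn_inter_le p b.1 b.2 z) le_rfl

/-! ### The diagrams of (7.4.2)–(7.4.4) at `p_c`, as products of `tauE` -/

section AtPc

/-- `τ_p(a - b) = τ_p(b - a)` in `ℝ≥0∞`. [cite: HeydenreichVanDerHofstad2017, (7.1.15)] -/
theorem tauE_sub_comm (p : unitInterval) (a b : Site d) : tauE d p (a - b) = tauE d p (b - a) := by
  rw [← tauE_neg, neg_sub]

/-- `A₃(s,u,v) = τ(v-s) τ(u-s) τ(v-u)` in `tauE` form. [cite: HeydenreichVanDerHofstad2017, (7.4.2)] -/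
theorem percA3_eq_tauE (s u v : Site d) :
    percA3 d s u v = tauE d (criticalProbI d) (v - s) * tauE d (criticalProbI d) (u - s) * tauE d (criticalProbI d) (v - u) := by
  unfold percA3
  rw [ENNReal.ofReal_mul (mul_nonneg (tau_nonneg _ _ _) (tau_nonneg _ _ _)),
    ENNReal.ofReal_mul (tau_nonneg _ _ _), ofReal_tau_eq_tauE, ofReal_tau_eq_tauE, ofReal_tau_eq_tauE]

/-- The pivotal two-point function of `LaceExpansionXSpaceLemma16.lean` is the tree's `τ̃`:
`τ̃(t, v) = τ̃_{p_c}(v - t)` in `ℝ≥0∞`. [cite: HeydenreichVanDerHofstad2017, (7.4.1) and (7.2.3)] -/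
theorem ofReal_tauTildePc (t v : Site d) : ENNReal.ofReal (tauTildePc d t v) = tauTildeE d (criticalProbI d) (v - t) := by
  have h : tauTildePc d t v = tauTilde d (criticalProbI d) (v - t) := by
    rw [tauTilde_def, latticeConv_bondJ]
    unfold tauTildePc
    congr 1
    refine Finset.sum_congr rfl fun i _ => ?_
    rw [tau_eq_tau_zero_sub _ (t + _) v, tau_eq_tau_zero_sub _ (t - _) v]
    congr 2
    · abel
    · abel
  rw [h, tauTildeE_def]

/-- `B₁(s,t,u,v) = τ̃(v-t) τ(u-s)` in `tauE` form. [cite: HeydenreichVanDerHofstad2017, (7.4.3)] -/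
theorem percB1_eq_tauE (s t u v : Site d) :
    percB1 d s t u v = tauTildeE d (criticalProbI d) (v - t) * tauE d (criticalProbI d) (u - s) := by
  unfold percB1
  rw [ENNReal.ofReal_mul (tauTildePc_nonneg _ _), ofReal_tauTildePc, ofReal_tau_eq_tauE]

/-- `B₂(u,v,s,t) = τ(v-u)τ(t-u)τ(s-v)τ(t-s) + δ_{v,s} Σ_a τ(a-s)τ(u-a)τ(t-a)τ(t-u)` in `tauE` form.
[cite: HeydenreichVanDerHofstad2017, (7.4.4)] -/
theorem percB2_eq_tauE (u v s t : Site d) :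
    percB2 d u v s t = tauE d (criticalProbI d) (v - u) * tauE d (criticalProbI d) (t - u) * tauE d (criticalProbI d) (s - v) * tauE d (criticalProbI d) (t - s) +
      if v = s then ∑' a, tauE d (criticalProbI d) (a - s) * tauE d (criticalProbI d) (u - a) * tauE d (criticalProbI d) (t - a) * tauE d (criticalProbI d) (t - u)
      else 0 := by
  unfold percB2
  congr 1
  · rw [ENNReal.ofReal_mul (mul_nonneg (mul_nonneg (tau_nonneg _ _ _) (tau_nonneg _ _ _)) (tau_nonneg _ _ _)),
      ENNReal.ofReal_mul (mul_nonneg (tau_nonneg _ _ _) (tau_nonneg _ _ _)),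
      ENNReal.ofReal_mul (tau_nonneg _ _ _), ofReal_tau_eq_tauE, ofReal_tau_eq_tauE, ofReal_tau_eq_tauE,
      ofReal_tau_eq_tauE]
  · split_ifs
    · refine tsum_congr fun a => ?_
      rw [ENNReal.ofReal_mul (mul_nonneg (mul_nonneg (tau_nonneg _ _ _) (tau_nonneg _ _ _)) (tau_nonneg _ _ _)),
        ENNReal.ofReal_mul (mul_nonneg (tau_nonneg _ _ _) (tau_nonneg _ _ _)),
        ENNReal.ofReal_mul (tau_nonneg _ _ _), ofReal_tau_eq_tauE, ofReal_tau_eq_tauE, ofReal_tau_eq_tauE,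
        ofReal_tau_eq_tauE]
    · rfl

/-- The innermost level is the closing triangle: `levelR 0 v z x = Σ_t τ(t-v) A₃(z,t,x)`.
[cite: HeydenreichVanDerHofstad2017, (7.3.8) and (7.4.6)] -/
theorem levelR_zero_eq (v z x : Site d) :
    levelR d (criticalProbI d) 0 v z x = ∑' t, tauE d (criticalProbI d) (t - v) * percA3 d z t x := by
  rw [levelR_zero]
  refine tsum_congr fun t => ?_
  rw [percA3_eq_tauE, tauE_sub_comm (criticalProbI d) z t]
  ring

/-- **One level, summed over `t`: `F'` gives `B₂⁽¹⁾`, `F''` gives `B₂⁽²⁾`** ((7.4.7)–(7.4.9) before the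
bond sum): `Σ_t stepF(v,t,z,u,w,z₂) = [Σ_t τ(t-v) B₂(z,t,w,u)] · τ(z₂-w)`.
[cite: HeydenreichVanDerHofstad2017, (7.4.7)–(7.4.9)] -/
theorem tsum_stepF_eq (v z u w z₂ : Site d) :
    ∑' t, stepF d (criticalProbI d) v t z u w z₂ = (∑' t, tauE d (criticalProbI d) (t - v) * percB2 d z t w u) * tauE d (criticalProbI d) (z₂ - w) := by
  -- split the right-hand side into the `B₂⁽¹⁾` and `B₂⁽²⁾` parts
  have hsplit : (∑' t, tauE d (criticalProbI d) (t - v) * percB2 d z t w u) =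
      (∑' t, tauE d (criticalProbI d) (t - v) * (tauE d (criticalProbI d) (t - z) * tauE d (criticalProbI d) (u - z) * tauE d (criticalProbI d) (w - t) * tauE d (criticalProbI d) (u - w))) +
        tauE d (criticalProbI d) (w - v) * ∑' a, tauE d (criticalProbI d) (a - w) * tauE d (criticalProbI d) (z - a) * tauE d (criticalProbI d) (u - a) * tauE d (criticalProbI d) (u - z) := by
    have h2 : (∑' t, tauE d (criticalProbI d) (t - v) * if t = w then
        ∑' a, tauE d (criticalProbI d) (a - w) * tauE d (criticalProbI d) (z - a) * tauE d (criticalProbI d) (u - a) * tauE d (criticalProbI d) (u - z) else 0) =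
        tauE d (criticalProbI d) (w - v) * ∑' a, tauE d (criticalProbI d) (a - w) * tauE d (criticalProbI d) (z - a) * tauE d (criticalProbI d) (u - a) * tauE d (criticalProbI d) (u - z) := by
      rw [tsum_eq_single w]
      · rw [if_pos rfl]
      · intro t ht
        rw [if_neg ht, mul_zero]
    rw [← h2, ← ENNReal.tsum_add]
    exact tsum_congr fun t => by rw [percB2_eq_tauE, mul_add]
  rw [hsplit, add_mul]
  unfold stepF
  rw [ENNReal.tsum_add]
  congr 1
  · rw [← ENNReal.tsum_mul_right]
    refine tsum_congr fun t => ?_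
    rw [tauE_sub_comm (criticalProbI d) z t]
    ring
  · rw [← ENNReal.tsum_mul_left, ← ENNReal.tsum_mul_right]
    exact tsum_congr fun t => by ring

end AtPc

/-! ### Re-association: the pairing of `Ψ^{(k)}` with the inside-out kernels -/

section Pairing

/-- Unfolding of `Ψ^{(N+1)}`. [cite: HeydenreichVanDerHofstad2017, (7.5.6)] -/
theorem percPsi_succ (N : ℕ) (w u : Site d) :
    percPsi d (N + 1) w u = ∑' q : Site d × Site d × Site d × Site d,
      percPsi d N q.1 q.2.1 * percB1 d q.1 q.2.1 q.2.2.1 q.2.2.2 * percB2 d q.2.2.1 q.2.2.2 w u :=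
  rfl

/-- The HALF STEP between the interface `(w, u)` of the book's recursion (branch vertex, bottom of
the next bond) and the interface `(v, z)` of the inside-out recursion (top of the bond, vertex of
the previous cluster): `H((w,u) → (v,z)) = J(u,v) τ(w,z)` (so that `Σ_v H τ(t-v) = B₁(w,u,z,t)`).
[cite: HeydenreichVanDerHofstad2017, (7.4.1) and (7.4.3)] -/
def halfStep (d : ℕ) (w u v z : Site d) : ℝ≥0∞ :=
  ENNReal.ofReal (bondJ d (criticalProbI d) (v - u)) * tauE d (criticalProbI d) (z - w)

/-- The pairing of `Ψ^{(k)}` with a kernel `g(v, z)` through one half step: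
`Σ_{(w,u)} Ψ^{(k)}(w,u) Σ_{(v,z)} H((w,u) → (v,z)) g(v,z)`. [cite: HeydenreichVanDerHofstad2017, (7.4.10) and (7.5.5)] -/
def pairPsi (d : ℕ) (k : ℕ) (g : Site d → Site d → ℝ≥0∞) : ℝ≥0∞ :=
  ∑' wu : Site d × Site d, percPsi d k wu.1 wu.2 *
    ∑' vz : Site d × Site d, halfStep d wu.1 wu.2 vz.1 vz.2 * g vz.1 vz.2

/-- One full level acting on inside-out kernels:
`(L g)(v, z) = Σ_{(w,u)} [Σ_t τ(t-v) B₂(z,t,w,u)] Σ_{(v',z')} H((w,u) → (v',z')) g(v',z')`.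
[cite: HeydenreichVanDerHofstad2017, (7.4.9)] -/
def levelOp (d : ℕ) (g : Site d → Site d → ℝ≥0∞) (v z : Site d) : ℝ≥0∞ :=
  ∑' wu : Site d × Site d, (∑' t, tauE d (criticalProbI d) (t - v) * percB2 d z t wu.1 wu.2) *
    ∑' vz : Site d × Site d, halfStep d wu.1 wu.2 vz.1 vz.2 * g vz.1 vz.2

/-- **The half step produces `B₁`**: `Σ_{(v,z)} H((w,u)→(v,z)) Σ_t τ(t-v) X(z,t) = Σ_{z,t} B₁(w,u,z,t) X(z,t)`
(`Σ_v J(u,v) τ_p(t-v) = τ̃_p(t-u)`, (7.4.6)–(7.4.7)). [cite: HeydenreichVanDerHofstad2017, (7.4.6)–(7.4.7)] -/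
theorem tsum_halfStep_mul_tsum (w u : Site d) (X : Site d → Site d → ℝ≥0∞) :
    ∑' vz : Site d × Site d, halfStep d w u vz.1 vz.2 * ∑' t, tauE d (criticalProbI d) (t - vz.1) * X vz.2 t =
      ∑' z, ∑' t, percB1 d w u z t * X z t := by
  rw [ENNReal.tsum_prod']
  calc ∑' v, ∑' z, halfStep d w u (v, z).1 (v, z).2 * ∑' t, tauE d (criticalProbI d) (t - (v, z).1) * X (v, z).2 t
      = ∑' v, ∑' z, ∑' t, ENNReal.ofReal (bondJ d (criticalProbI d) (v - u)) * tauE d (criticalProbI d) (t - v) *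
          (tauE d (criticalProbI d) (z - w) * X z t) := by
        refine tsum_congr fun v => tsum_congr fun z => ?_
        dsimp only
        rw [halfStep, ← ENNReal.tsum_mul_left]
        exact tsum_congr fun t => by ring
    _ = ∑' z, ∑' t, ∑' v, ENNReal.ofReal (bondJ d (criticalProbI d) (v - u)) * tauE d (criticalProbI d) (t - v) *
          (tauE d (criticalProbI d) (z - w) * X z t) := by
        rw [ENNReal.tsum_comm]
        exact tsum_congr fun z => ENNReal.tsum_comm
    _ = ∑' z, ∑' t, percB1 d w u z t * X z t := by
        refine tsum_congr fun z => tsum_congr fun t => ?_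
        rw [ENNReal.tsum_mul_right, tsum_bondJ_mul_tauE, percB1_eq_tauE]
        ring

/-- Four-fold product sums as iterated sums (Tonelli in `[0,∞]`). [folklore] -/
theorem tsum_prod4 (f : Site d × Site d × Site d × Site d → ℝ≥0∞) :
    ∑' q, f q = ∑' a, ∑' b, ∑' c, ∑' e, f (a, b, c, e) := by
  rw [ENNReal.tsum_prod']
  refine tsum_congr fun a => ?_
  rw [ENNReal.tsum_prod']
  refine tsum_congr fun b => ?_
  rw [ENNReal.tsum_prod']

/-- The pairing is monotone in the kernel. [folklore] -/
theorem pairPsi_mono (k : ℕ) {g g' : Site d → Site d → ℝ≥0∞} (h : ∀ v z, g v z ≤ g' v z) :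
    pairPsi d k g ≤ pairPsi d k g' :=
  ENNReal.tsum_le_tsum fun _ => mul_le_mul' le_rfl
    (ENNReal.tsum_le_tsum fun vz => mul_le_mul' le_rfl (h vz.1 vz.2))

/-- **The diagram is a pairing**: `piNDiagramPc d (k+1) x = ⟨Ψ^{(k)}, H · [Σ_t τ(t-v) A₃(z,t,x)]⟩`.
[cite: HeydenreichVanDerHofstad2017, (7.4.10) and (7.5.5)] -/
theorem piNDiagramPc_succ_eq_pairPsi (k : ℕ) (x : Site d) :
    piNDiagramPc d (k + 1) x = pairPsi d k (fun v z => ∑' t, tauE d (criticalProbI d) (t - v) * percA3 d z t x) := by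
  unfold pairPsi
  rw [piNDiagramPc_succ, tsum_prod4, ENNReal.tsum_prod']
  refine tsum_congr fun w => tsum_congr fun u => ?_
  dsimp only
  rw [tsum_halfStep_mul_tsum w u (fun z t => percA3 d z t x), ← ENNReal.tsum_mul_left]
  refine tsum_congr fun z => ?_
  rw [← ENNReal.tsum_mul_left]
  exact tsum_congr fun t => by ring

/-- **One level of re-association** ("the ratios of two-point functions form a telescoping
product"): `⟨Ψ^{(k)}, H · L g⟩ = ⟨Ψ^{(k+1)}, H · g⟩`. [cite: HeydenreichVanDerHofstad2017, (7.4.9)–(7.4.10) and (7.5.6)] -/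
theorem pairPsi_levelOp (k : ℕ) (g : Site d → Site d → ℝ≥0∞) :
    pairPsi d k (levelOp d g) = pairPsi d (k + 1) g := by
  -- abbreviation for the outgoing half step
  set Y : Site d → Site d → ℝ≥0∞ := fun w' u' =>
    ∑' vz : Site d × Site d, halfStep d w' u' vz.1 vz.2 * g vz.1 vz.2 with hY
  -- `L g` in the form `Σ_t τ(t-v) X(z,t)`
  have hL : ∀ v z, levelOp d g v z =
      ∑' t, tauE d (criticalProbI d) (t - v) * ∑' wu : Site d × Site d, percB2 d z t wu.1 wu.2 * Y wu.1 wu.2 := by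
    intro v z
    unfold levelOp
    calc ∑' wu : Site d × Site d, (∑' t, tauE d (criticalProbI d) (t - v) * percB2 d z t wu.1 wu.2) * Y wu.1 wu.2
        = ∑' wu : Site d × Site d, ∑' t, tauE d (criticalProbI d) (t - v) * (percB2 d z t wu.1 wu.2 * Y wu.1 wu.2) := by
          refine tsum_congr fun wu => ?_
          rw [← ENNReal.tsum_mul_right]
          exact tsum_congr fun t => by ring
      _ = ∑' t, ∑' wu : Site d × Site d, tauE d (criticalProbI d) (t - v) * (percB2 d z t wu.1 wu.2 * Y wu.1 wu.2) :=
          ENNReal.tsum_comm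
      _ = _ := tsum_congr fun t => by rw [ENNReal.tsum_mul_left]
  have hfun : levelOp d g = fun v z =>
      ∑' t, tauE d (criticalProbI d) (t - v) * ∑' wu : Site d × Site d, percB2 d z t wu.1 wu.2 * Y wu.1 wu.2 :=
    funext fun v => funext fun z => hL v z
  calc pairPsi d k (levelOp d g)
      = ∑' wu : Site d × Site d, percPsi d k wu.1 wu.2 * ∑' z, ∑' t, percB1 d wu.1 wu.2 z t *
          ∑' wu' : Site d × Site d, percB2 d z t wu'.1 wu'.2 * Y wu'.1 wu'.2 := by
        unfold pairPsi
        refine tsum_congr fun wu => ?_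
        rw [hfun, tsum_halfStep_mul_tsum wu.1 wu.2
          (fun z t => ∑' wu' : Site d × Site d, percB2 d z t wu'.1 wu'.2 * Y wu'.1 wu'.2)]
    _ = ∑' wu : Site d × Site d, ∑' z, ∑' t, ∑' wu' : Site d × Site d,
          percPsi d k wu.1 wu.2 * percB1 d wu.1 wu.2 z t * percB2 d z t wu'.1 wu'.2 * Y wu'.1 wu'.2 := by
        refine tsum_congr fun wu => ?_
        rw [← ENNReal.tsum_mul_left]
        refine tsum_congr fun z => ?_
        rw [← ENNReal.tsum_mul_left]
        refine tsum_congr fun t => ?_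
        rw [← ENNReal.tsum_mul_left, ← ENNReal.tsum_mul_left]
        exact tsum_congr fun wu' => by ring
    _ = ∑' wu : Site d × Site d, ∑' z, ∑' wu' : Site d × Site d, ∑' t,
          percPsi d k wu.1 wu.2 * percB1 d wu.1 wu.2 z t * percB2 d z t wu'.1 wu'.2 * Y wu'.1 wu'.2 :=
        tsum_congr fun wu => tsum_congr fun z => ENNReal.tsum_comm
    _ = ∑' wu : Site d × Site d, ∑' wu' : Site d × Site d, ∑' z, ∑' t,
          percPsi d k wu.1 wu.2 * percB1 d wu.1 wu.2 z t * percB2 d z t wu'.1 wu'.2 * Y wu'.1 wu'.2 :=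
        tsum_congr fun wu => ENNReal.tsum_comm
    _ = ∑' wu' : Site d × Site d, ∑' wu : Site d × Site d, ∑' z, ∑' t,
          percPsi d k wu.1 wu.2 * percB1 d wu.1 wu.2 z t * percB2 d z t wu'.1 wu'.2 * Y wu'.1 wu'.2 :=
        ENNReal.tsum_comm
    _ = ∑' wu' : Site d × Site d, percPsi d (k + 1) wu'.1 wu'.2 * Y wu'.1 wu'.2 := by
        refine tsum_congr fun wu' => ?_
        rw [percPsi_succ, tsum_prod4, ENNReal.tsum_prod', ← ENNReal.tsum_mul_right]
        refine tsum_congr fun w => ?_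
        dsimp only
        rw [← ENNReal.tsum_mul_right]
        refine tsum_congr fun u => ?_
        rw [← ENNReal.tsum_mul_right]
        refine tsum_congr fun z => ?_
        rw [← ENNReal.tsum_mul_right]
    _ = pairPsi d (k + 1) g := rfl

end Pairing

/-! ### Matching the inside-out recursion with `Ψ^{(N)}`, and the discharge -/

section Matching

/-- Moving the innermost of four sums to the front (Tonelli in `[0,∞]`). [folklore] -/
theorem tsum_comm4_last_to_first (F : Site d → Site d → Site d → Site d → ℝ≥0∞) :
    ∑' u, ∑' v, ∑' z, ∑' w, F u v z w = ∑' w, ∑' u, ∑' v, ∑' z, F u v z w :=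
  calc ∑' u, ∑' v, ∑' z, ∑' w, F u v z w = ∑' u, ∑' v, ∑' w, ∑' z, F u v z w :=
        tsum_congr fun _ => tsum_congr fun _ => ENNReal.tsum_comm
    _ = ∑' u, ∑' w, ∑' v, ∑' z, F u v z w := tsum_congr fun _ => ENNReal.tsum_comm
    _ = ∑' w, ∑' u, ∑' v, ∑' z, F u v z w := ENNReal.tsum_comm

/-- **The inside-out recursion is the level operator** (at `p_c`):
`levelR (k+1) v z x = (L · levelR k · · x)(v, z)` — the sum over the far end of the bond gives `J`
in the half step, the sum over `t` gives `B₂` (`tsum_stepF_eq`). [cite: HeydenreichVanDerHofstad2017, (7.4.7)–(7.4.9)] -/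
theorem levelR_succ_eq_levelOp (k : ℕ) (v z x : Site d) :
    levelR d (criticalProbI d) (k + 1) v z x = levelOp d (fun v' z₂ => levelR d (criticalProbI d) k v' z₂ x) v z := by
  -- both sides as `Σ_w Σ_u Σ_{v'} Σ_{z₂} J(v'-u) [Σ_t τ(t-v)B₂(z,t,w,u)] τ(z₂-w) levelR k v' z₂ x`
  have lhs : levelR d (criticalProbI d) (k + 1) v z x = ∑' u, ∑' v', ∑' z₂, ∑' w,
      ENNReal.ofReal (bondJ d (criticalProbI d) (v' - u)) * (∑' t, tauE d (criticalProbI d) (t - v) * percB2 d z t w u) *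
        tauE d (criticalProbI d) (z₂ - w) * levelR d (criticalProbI d) k v' z₂ x := by
    rw [levelR_succ, ENNReal.tsum_prod']
    refine tsum_congr fun u => tsum_congr fun v' => tsum_congr fun z₂ => ?_
    dsimp only
    rw [ENNReal.tsum_comm]
    refine tsum_congr fun w => ?_
    rw [ENNReal.tsum_mul_right, ENNReal.tsum_mul_left, tsum_stepF_eq]
    ring
  have rhs : levelOp d (fun v' z₂ => levelR d (criticalProbI d) k v' z₂ x) v z = ∑' w, ∑' u, ∑' v', ∑' z₂,
      ENNReal.ofReal (bondJ d (criticalProbI d) (v' - u)) * (∑' t, tauE d (criticalProbI d) (t - v) * percB2 d z t w u) *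
        tauE d (criticalProbI d) (z₂ - w) * levelR d (criticalProbI d) k v' z₂ x := by
    unfold levelOp
    rw [ENNReal.tsum_prod']
    refine tsum_congr fun w => tsum_congr fun u => ?_
    dsimp only
    rw [ENNReal.tsum_prod', ← ENNReal.tsum_mul_left]
    refine tsum_congr fun v' => ?_
    rw [← ENNReal.tsum_mul_left]
    refine tsum_congr fun z₂ => ?_
    dsimp only
    rw [halfStep]
    ring
  rw [lhs, rhs]
  exact tsum_comm4_last_to_first _

/-- **The first level is the pairing with `Ψ^{(0)} = A₃(0,u₀,w₀)`** ((7.4.5)):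
`Σ_{(u₀,v₀)} J Σ_{z₁} [Σ_{w₀} τ(u₀)τ(w₀)τ(u₀-w₀)τ(z₁-w₀)] R(v₀,z₁) = ⟨Ψ^{(0)}, H · R⟩`.
[cite: HeydenreichVanDerHofstad2017, (7.4.5) and (7.5.5)] -/
theorem outer_eq_pairPsi_zero (R : Site d → Site d → ℝ≥0∞) :
    ∑' b : Site d × Site d, ENNReal.ofReal (bondJ d (criticalProbI d) (b.2 - b.1)) *
      ∑' z₁, (∑' w, tauE d (criticalProbI d) b.1 * tauE d (criticalProbI d) w * tauE d (criticalProbI d) (b.1 - w) * tauE d (criticalProbI d) (z₁ - w)) * R b.2 z₁ =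
      pairPsi d 0 R := by
  have lhs : (∑' b : Site d × Site d, ENNReal.ofReal (bondJ d (criticalProbI d) (b.2 - b.1)) *
      ∑' z₁, (∑' w, tauE d (criticalProbI d) b.1 * tauE d (criticalProbI d) w * tauE d (criticalProbI d) (b.1 - w) * tauE d (criticalProbI d) (z₁ - w)) * R b.2 z₁) =
      ∑' u, ∑' v', ∑' z₁, ∑' w, ENNReal.ofReal (bondJ d (criticalProbI d) (v' - u)) *
        (tauE d (criticalProbI d) w * tauE d (criticalProbI d) u * tauE d (criticalProbI d) (w - u)) * tauE d (criticalProbI d) (z₁ - w) * R v' z₁ := by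
    rw [ENNReal.tsum_prod']
    refine tsum_congr fun u => tsum_congr fun v' => ?_
    dsimp only
    rw [← ENNReal.tsum_mul_left]
    refine tsum_congr fun z₁ => ?_
    rw [← ENNReal.tsum_mul_right, ← ENNReal.tsum_mul_left]
    refine tsum_congr fun w => ?_
    rw [tauE_sub_comm (criticalProbI d) u w]
    ring
  have rhs : pairPsi d 0 R = ∑' w, ∑' u, ∑' v', ∑' z₁, ENNReal.ofReal (bondJ d (criticalProbI d) (v' - u)) *
      (tauE d (criticalProbI d) w * tauE d (criticalProbI d) u * tauE d (criticalProbI d) (w - u)) * tauE d (criticalProbI d) (z₁ - w) * R v' z₁ := by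
    unfold pairPsi
    rw [ENNReal.tsum_prod']
    refine tsum_congr fun w => tsum_congr fun u => ?_
    dsimp only
    rw [show percPsi d 0 w u = percA3 d 0 u w from rfl, percA3_eq_tauE, sub_zero, sub_zero,
      ENNReal.tsum_prod', ← ENNReal.tsum_mul_left]
    refine tsum_congr fun v' => ?_
    rw [← ENNReal.tsum_mul_left]
    refine tsum_congr fun z₁ => ?_
    dsimp only
    rw [halfStep]
    ring
  rw [lhs, rhs]
  exact tsum_comm4_last_to_first _

/-- **The two nestings agree**: pairing `Ψ^{(j)}` with the inside-out bound of `N + 1` levels gives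
the diagram with `j + N + 1` levels: `⟨Ψ^{(j)}, H · levelR N · · x⟩ = piNDiagramPc d (j + N + 1) x`.
[cite: HeydenreichVanDerHofstad2017, (7.4.10) and (7.5.5)–(7.5.6)] -/
theorem pairPsi_levelR (x : Site d) :
    ∀ (N j : ℕ), pairPsi d j (fun v z => levelR d (criticalProbI d) N v z x) = piNDiagramPc d (j + N + 1) x
  | 0, j => by
      have h : (fun v z => levelR d (criticalProbI d) 0 v z x) = fun v z => ∑' t, tauE d (criticalProbI d) (t - v) * percA3 d z t x :=
        funext fun v => funext fun z => levelR_zero_eq v z x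
      rw [h, ← piNDiagramPc_succ_eq_pairPsi]
  | N + 1, j => by
      have h : (fun v z => levelR d (criticalProbI d) (N + 1) v z x) =
          levelOp d (fun v' z₂ => levelR d (criticalProbI d) N v' z₂ x) :=
        funext fun v => funext fun z => levelR_succ_eq_levelOp N v z x
      rw [h, pairPsi_levelOp, pairPsi_levelR x N (j + 1)]
      congr 1
      omega

/-- **Heydenreich–van der Hofstad (7.4.10), pointwise, for the tree's coefficients at `p_c`**:
for `N ≥ 1` and every `x`,
`Π̃^{(N)}_{p_c}(x) ≤ Σ A₃(0,u₀,w₀) ∏_{i=1}^{N-1} [B₁B₂] B₁(w_{N-1},u_{N-1},z_N,t_N) A₃(z_N,t_N,x) = piNDiagramPc d N x`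
("valid for all `N ≥ 1`"). [cite: HeydenreichVanDerHofstad2017, (7.3.8)–(7.3.11) and (7.4.5)–(7.4.10)] [cite: HaraSlade1990, §2.2] -/
theorem lacePiT_le_piNDiagramPc (N : ℕ) (x : Site d) (hN : 1 ≤ N) :
    lacePiT d (criticalProbI d) N x ≤ piNDiagramPc d N x := by
  obtain ⟨M, rfl⟩ : ∃ M, N = M + 1 := ⟨N - 1, by omega⟩
  calc lacePiT d (criticalProbI d) (M + 1) x ≤ _ := lacePiT_succ_le_levelR (criticalProbI d) M x
    _ = pairPsi d 0 (fun v z => levelR d (criticalProbI d) M v z x) :=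
        outer_eq_pairPsi_zero (fun v z => levelR d (criticalProbI d) M v z x)
    _ = piNDiagramPc d (0 + M + 1) x := pairPsi_levelR x M 0
    _ = piNDiagramPc d (M + 1) x := by rw [Nat.zero_add]

end Matching

/-! ### The named fact -/

/-- DISCHARGE of the named fact `HvdH2017_piNDiagramBoundPc` (`LaceExpansionXSpaceLemma16.lean`) —
**the Hara–Slade coefficients at `p_c` and their diagrammatic bounds, `d ≥ 11`, given the
summability of the bounding diagrams**: the pointwise bound (7.4.10) just proved is the last input
of `HvdH2017_piNDiagramBoundPc_of_pointwiseBound7410` (`LaceExpansionXSpaceLemma16Proofs.lean`: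
(7.2.9), `θ(p_c) = 0`, Prop. 6.1 at `p_c`, `M → ∞`, identification with the coefficient `Φ`).
[cite: HeydenreichVanDerHofstad2017, Prop. 6.1, Lemma 7.1 ((7.2.9)), (7.4.10) and Cor. 8.13 (proof, p = p_c)]
[cite: Hara2008, Prop. 1.2 and Appendix A] [cite: HaraSlade1990, §2.2] -/
theorem HvdH2017_piNDiagramBoundPc_holds : HvdH2017_piNDiagramBoundPc :=
  HvdH2017_piNDiagramBoundPc_of_pointwiseBound7410 fun _ _ N x hN => lacePiT_le_piNDiagramPc N x hN

end Literature.Barriers.CriticalPhenomena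

end
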